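import Summits.KontsevichZagierPeriods.KontsevichZagierPeriods.Theorems.ValuedFieldSpecialisationClassLevelExpansionFibreDimOneToolkit

/-!
# Route ValuedFieldSpecialisation — rational powers of a coordinate are semialgebraic

Helper for item stmt-KontsevichZagierPeriods-3503 (`ClassLevelExpansionFibreDimOne`): the map
`v ↦ (v i) ^ (p/q)` (`0 < q`) is `ℚ`-semialgebraic on every `ℚ`-semialgebraic set where `v i > 0`
(its graph is `{0 < t, t^q = (v i)^p}`), together with the same for negative exponents
`(v i) ^ (−p/q)`. Source: J. Bochnak, M. Coste, M.-F. Roy (1998), §2.2. Deliberately NOT here: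
anything about representations.
-/

noncomputable section

namespace Summit.KontsevichZagierPeriods.ValuedFieldSpecialisation

open Set MvPolynomial
open Literature.NumberTheory.Transcendental
open Literature.ModelTheory.ExponentialFields (IsSemialgebraic isSemialgebraic_setOf_eval_pos
  isSemialgebraic_setOf_eval_eq_zero)

/-! ### Rational powers of a positive coordinate are semialgebraic -/

/-- For `0 < y` and `0 < q`: `t = y ^ (p/q)` iff `0 < t` and `t ^ q = y ^ p`. [folklore] -/
theorem eq_rpow_div_iff {y t : ℝ} (hy : 0 < y) {p q : ℕ} (hq : 0 < q) :
    t = y ^ ((p : ℝ) / q) ↔ 0 < t ∧ t ^ q = y ^ p := by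
  have hq0 : (q : ℝ) ≠ 0 := by exact_mod_cast hq.ne'
  have key : (y ^ ((p : ℝ) / q)) ^ q = y ^ p := by
    rw [← Real.rpow_natCast (y ^ ((p : ℝ) / q)) q, ← Real.rpow_mul hy.le, div_mul_cancel₀ _ hq0,
      Real.rpow_natCast]
  constructor
  · rintro rfl; exact ⟨Real.rpow_pos_of_pos hy _, key⟩
  · rintro ⟨ht, h⟩
    exact (pow_left_inj₀ ht.le (Real.rpow_nonneg hy.le _) hq.ne').mp (h.trans key.symm)

/-- **`v ↦ (v i) ^ (p/q)` is `ℚ`-semialgebraic** on any `ℚ`-semialgebraic `B ⊆ {0 < v i}`.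
[Bochnak–Coste–Roy 1998, §2.2] [folklore] -/
theorem isSemialgebraicFunOn_rpow_coord {n : ℕ} {B : Set (Fin n → ℝ)} (hB : IsSemialgebraic ℚ B)
    (i : Fin n) (hB0 : ∀ v ∈ B, 0 < v i) {p q : ℕ} (hq : 0 < q) :
    IsSemialgebraicFunOn ℚ B (fun v => (v i) ^ ((p : ℝ) / q)) := by
  rw [isSemialgebraicFunOn_iff]
  have h1 : IsSemialgebraic ℚ {w : Fin (n + 1) → ℝ | 0 < w (Fin.last n)} := by
    simpa using isSemialgebraic_setOf_eval_pos (k := ℚ) (R := ℝ) (X (Fin.last n))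
  have h2 : IsSemialgebraic ℚ {w : Fin (n + 1) → ℝ | w (Fin.last n) ^ q = w (Fin.castSucc i) ^ p} := by
    have := isSemialgebraic_setOf_eval_eq_zero (k := ℚ) (R := ℝ)
      ((X (Fin.last n) : MvPolynomial (Fin (n + 1)) ℚ) ^ q - X (Fin.castSucc i) ^ p)
    convert this using 2 with w
    simp [sub_eq_zero]
  convert (hB.setOf_init_mem.inter h1).inter h2 using 1
  ext w
  simp only [mem_setOf_eq, mem_inter_iff]
  have hi : (Fin.init w) i = w (Fin.castSucc i) := rfl
  constructor
  · rintro ⟨hw, hlast⟩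
    have := (eq_rpow_div_iff (hB0 _ hw) hq).mp hlast
    rw [hi] at this
    exact ⟨⟨hw, this.1⟩, this.2⟩
  · rintro ⟨⟨hw, hpos⟩, heq⟩
    exact ⟨hw, (eq_rpow_div_iff (hB0 _ hw) hq).mpr ⟨hpos, heq⟩⟩

/-- **`v ↦ (v i) ^ (−p/q)` is `ℚ`-semialgebraic** on any `ℚ`-semialgebraic `B ⊆ {0 < v i}` (the
inverse of the positive function `(v i) ^ (p/q)`). [Bochnak–Coste–Roy 1998, §2.2] [folklore] -/
theorem isSemialgebraicFunOn_rpow_coord_neg {n : ℕ} {B : Set (Fin n → ℝ)} (hB : IsSemialgebraic ℚ B)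
    (i : Fin n) (hB0 : ∀ v ∈ B, 0 < v i) {p q : ℕ} (hq : 0 < q) :
    IsSemialgebraicFunOn ℚ B (fun v => (v i) ^ (-(p : ℝ) / q)) := by
  refine ((isSemialgebraicFunOn_rpow_coord hB i hB0 (p := p) hq).inv fun v hv =>
    (Real.rpow_pos_of_pos (hB0 v hv) _).ne').congr fun v hv => ?_
  rw [neg_div, Real.rpow_neg (hB0 v hv).le]

/-- Real exponent version: for a rational `r`, `v ↦ (v i) ^ (r : ℝ)` is `ℚ`-semialgebraic on any
`ℚ`-semialgebraic `B ⊆ {0 < v i}`. [Bochnak–Coste–Roy 1998, §2.2] [folklore] -/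
theorem isSemialgebraicFunOn_rpow_coord_rat {n : ℕ} {B : Set (Fin n → ℝ)} (hB : IsSemialgebraic ℚ B)
    (i : Fin n) (hB0 : ∀ v ∈ B, 0 < v i) (r : ℚ) :
    IsSemialgebraicFunOn ℚ B (fun v => (v i) ^ (r : ℝ)) := by
  have hq : 0 < r.den := r.den_pos
  rcases le_or_gt 0 r.num with hnum | hnum
  · have : (r : ℝ) = ((r.num.toNat : ℕ) : ℝ) / r.den := by
      rw [Rat.cast_def]
      congr 1
      have : ((r.num.toNat : ℕ) : ℤ) = r.num := Int.toNat_of_nonneg hnum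
      exact_mod_cast this.symm
    rw [this]
    exact isSemialgebraicFunOn_rpow_coord hB i hB0 hq
  · have : (r : ℝ) = -((r.num.natAbs : ℕ) : ℝ) / r.den := by
      rw [Rat.cast_def]
      congr 1
      have : ((r.num.natAbs : ℕ) : ℤ) = -r.num := by omega
      have h' : (r.num : ℝ) = -((r.num.natAbs : ℕ) : ℝ) := by exact_mod_cast (by omega : r.num = -((r.num.natAbs : ℕ) : ℤ))
      exact h'
    rw [this]
    exact isSemialgebraicFunOn_rpow_coord_neg hB i hB0 hq

end Summit.KontsevichZagierPeriods.ValuedFieldSpecialisation
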